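import Literature.Analysis.FluidPDE.HeatKernelFwdSmooth
import Literature.Analysis.FluidPDE.HeatPotentialTestRepresentation
import Literature.Analysis.FluidPDE.CaloricRepresentationNu
import Literature.Analysis.FluidPDE.DistributionalPressurePoisson
import Literature.Analysis.Distribution.SmoothCutoff
import Mathlib.Analysis.Calculus.ContDiff.Convolution
import HarnessLib

/-!
# Far-field smoothness of space–time potentials and their re-expansion as heat potentials

Analysis/FluidPDE support file (everything proved) in the decomposition of the named fact
`Literature.Analysis.FluidPDE.LemarieRieusset2016.lemma13_6_duhamel` (`CKNMorreyHolder.lean`: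
Lemarié-Rieusset 2016, §13.9 Step 3 and the proof of Lemma 13.6, pp. 474–478). In the duality
form of the localised equations the terms carrying *spatial derivatives of the cut-off* are
pairings of data supported in an annulus (the pressure, `|u|²`, times derivatives of the cut-off)
with caloric fields; after the duality passage they are potentials `∫ k(w - z) F(z) dz` of
integrable data `F` supported in a compact set `A` against kernels `k` which are smooth on a
region `O` containing `Ū - A`, `U` a neighbourhood of the cylinder of interest (spatial
separation: on `O = ℝ × {‖y‖ > r₁ + ε}` the kernels — the zero-extended heat kernel and the
zero-extended first two derivatives of the heat flow of the truncated Newtonian kernel of radius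
`r₁` — are `C^∞`, across `τ = 0` included). Such potentials are smooth on `U`, hence agree on the
cylinder with heat potentials of smooth compactly supported data (the identity
`heatPotential ν ((∂ₜ - νΔ)Φ) = Φ` of `HeatPotentialTestRepresentation.lean`). This file proves:

* `ContDiffOn.slice_fderiv_apply` — slice derivatives `p ↦ ∂ᵥ K(p.1, ·)(p.2)` of a function
  smooth on an open set of `ℝ × E` are smooth there;
* `contDiffOn_conv_heatKernelFwd` — for a locally integrable profile `ρ` supported in `‖y‖ ≤ r`,
  `(θ, v) ↦ ∫ ρ(y) W₊(θ, v - y) dy` is `C^∞` on `ℝ × {‖v‖ > r + ε}` (Mathlib's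
  `contDiffOn_convolution_right_with_param` with the kernel cut off near the spatial origin, where
  it is never evaluated), and, in dimension three, the reflected backward kernels of the families
  `a ↦ G_{νa}`, `a ↦ ∂_c e^{νaΔ}Γ₀`, `a ↦ ∂ᵥ∂_c e^{νaΔ}Γ₀` are this function and its slice
  derivatives composed with `(θ, v) ↦ (θ, -v)` (`backKernel_heatKernel_reflect_eq`,
  `backKernel_heatD1_newtonNear_reflect_eq`, `backKernel_heatD2_newtonNear_reflect_eq`), hence
  smooth on `ℝ × {‖v‖ > r₁ + ε}` (`contDiffOn_backKernel_…_reflect`);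
* `contDiffOn_integral_kernel_of_separated` — **far-field smoothness**: `k` smooth on an open
  `O`, `F ∈ L¹` vanishing off a compact `A`, `U` bounded open with `closure U - A ⊆ O` ⟹
  `w ↦ ∫ k(w - z) F(z) dz` is `C^∞` on `U` (a smooth cut-off of `k` to `O`, the tree's
  `exists_smooth_cutoff`, and `HasCompactSupport.contDiff_convolution_left`);
* `exists_heatPotential_eq_of_contDiffOn` — **re-expansion**: a function smooth on an open
  `U ⊆ ℝ × E` agrees on any compact `K ⊆ U` with `heatPotential ν β` for a continuous `β` with
  compact support inside `U` (`β = (∂ₜ - νΔ)(χR)`, `χ` a cut-off).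

## Mathlib / tree search

Tree (all used): `heatKernelFwd`, `heatPotential` (`ParabolicHeatPotentials`),
`contDiffOn_heatKernelFwd` (`HeatKernelFwdSmooth`), `IsSpaceTimeTestOn.heatPotential_heatOperator`
(`HeatPotentialTestRepresentation`), `backKernel`, `heatD1`, `heatD2`, `newtonNear`
(`CaloricBackwardKernels`, `OseenHeat`, `NewtonKernel`), `convolution_lsmul_real_prod_apply`,
`isAddLeftInvariant_volume_real_prod`, `isNegInvariant_volume_real_prod`
(`CaloricPotentialContinuity`), `exists_smooth_cutoff` (`Distribution/SmoothCutoff`),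
`IsSpaceTimeTestOn.continuous_timeDeriv`, `.timeDeriv_eq_zero_of_notMem`,
`laplacian_slice_eq_zero_of_notMem_tsupport`. Mathlib: `contDiffOn_convolution_right_with_param`,
`HasCompactSupport.contDiff_convolution_left`, `ContDiffBump`,
`IsCompact.exists_cthickening_subset_open`, `ContDiffOn.fderiv_of_isOpen`, `hasFDerivAt_prodMk_right`.

## References

* P. G. Lemarié-Rieusset, *The Navier–Stokes Problem in the 21st Century*, CRC Press (2016),
  Prop. 13.4 proof p. 465, §13.9 Step 3, (13.50)–(13.52), pp. 474–475. [LemarieRieusset2016]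
* L. C. Evans, *Partial Differential Equations*, 2nd ed. (2010), §2.3.1.
-/

noncomputable section

open MeasureTheory Set Function Filter Metric Real ContinuousLinearMap TopologicalSpace
open scoped ENNReal NNReal Topology RealInnerProductSpace Convolution ContDiff Laplacian Pointwise

namespace Literature.Analysis.FluidPDE

section General

variable {E : Type*} [NormedAddCommGroup E] [InnerProductSpace ℝ E] [FiniteDimensional ℝ E]
  [MeasurableSpace E] [BorelSpace E]

/-! ### Slice derivatives of functions smooth on an open set of `ℝ × E` -/

omit [MeasurableSpace E] [BorelSpace E] [FiniteDimensional ℝ E] in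
/-- The slice derivative is the full derivative on `(0, c)`: for `K` smooth on an open `O ∋ p`,
`∂ᵥ(K(p.1, ·))(p.2) c = DK(p)(0, c)`. [folklore] -/
theorem fderiv_slice_eq_fderiv_apply {K : ℝ × E → ℝ} {O : Set (ℝ × E)} (hO : IsOpen O)
    (hK : ContDiffOn ℝ ∞ K O) {p : ℝ × E} (hp : p ∈ O) (c : E) :
    fderiv ℝ (fun v => K (p.1, v)) p.2 c = fderiv ℝ K p (0, c) := by
  have hd : DifferentiableAt ℝ K p :=
    (hK.contDiffAt (hO.mem_nhds hp)).differentiableAt (by simp)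
  have h1 : HasFDerivAt (fun v : E => ((p.1, v) : ℝ × E)) (ContinuousLinearMap.inr ℝ ℝ E) p.2 :=
    hasFDerivAt_prodMk_right p.1 p.2
  have h2 : HasFDerivAt (fun v : E => K (p.1, v)) ((fderiv ℝ K p).comp (ContinuousLinearMap.inr ℝ ℝ E))
      p.2 := hd.hasFDerivAt.comp p.2 h1
  rw [h2.fderiv]
  rfl

omit [MeasurableSpace E] [BorelSpace E] [FiniteDimensional ℝ E] in
/-- **Slice derivatives of a function smooth on an open set are smooth there.** [folklore] -/
theorem ContDiffOn.slice_fderiv_apply {K : ℝ × E → ℝ} {O : Set (ℝ × E)} (hO : IsOpen O)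
    (hK : ContDiffOn ℝ ∞ K O) (c : E) :
    ContDiffOn ℝ ∞ (fun p : ℝ × E => fderiv ℝ (fun v => K (p.1, v)) p.2 c) O := by
  have h1 : ContDiffOn ℝ ∞ (fun p : ℝ × E => fderiv ℝ K p (0, c)) O :=
    (hK.fderiv_of_isOpen hO (by simp)).clm_apply contDiffOn_const
  exact h1.congr fun p hp => fderiv_slice_eq_fderiv_apply hO hK hp c

omit [MeasurableSpace E] [BorelSpace E] [FiniteDimensional ℝ E] in
/-- The spatial reflection `(θ, v) ↦ (θ, -v)` is smooth. [folklore] -/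
theorem contDiff_timeId_spaceNeg : ContDiff ℝ ∞ fun q : ℝ × E => ((q.1, -q.2) : ℝ × E) :=
  contDiff_fst.prodMk contDiff_snd.neg

/-! ### The zero-extended heat flow of a compactly supported profile off the profile -/

section Conv

variable {ν : ℝ} {ρ : E → ℝ} {r : ℝ}

/-- **Smoothness of `(θ, v) ↦ ∫ ρ(y) W₊(θ, v - y) dy` away from the profile**: for `ρ` locally
integrable and supported in `‖y‖ ≤ r`, `ν > 0`, `ε > 0`, the function is `C^∞` on
`ℝ × {‖v‖ > r + ε}` (only values `W₊(θ, y')` with `‖y'‖ > ε` enter, and `W₊` is smooth there;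
Mathlib's convolution-with-parameter smoothness after cutting the kernel off near `y' = 0` and at
infinity). [folklore] -/
theorem contDiffOn_conv_heatKernelFwd (hρi : LocallyIntegrable ρ volume)
    (hρsupp : ∀ y, ρ y ≠ 0 → ‖y‖ ≤ r) (hν : 0 < ν) {ε : ℝ} (hε : 0 < ε) :
    ContDiffOn ℝ ∞ (fun p : ℝ × E => ∫ y, ρ y * heatKernelFwd ν (p.1, p.2 - y))
      {p : ℝ × E | r + ε < ‖p.2‖} := by
  -- it suffices to work on the bounded pieces `r + ε < ‖v‖ < R₀`
  suffices hpiece : ∀ R₀ : ℝ, ContDiffOn ℝ ∞ (fun p : ℝ × E => ∫ y, ρ y * heatKernelFwd ν (p.1, p.2 - y))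
      {p : ℝ × E | r + ε < ‖p.2‖ ∧ ‖p.2‖ < R₀} by
    intro p hp
    have hopen : IsOpen {q : ℝ × E | r + ε < ‖q.2‖ ∧ ‖q.2‖ < ‖p.2‖ + 1} := by
      have h1 : IsOpen {q : ℝ × E | r + ε < ‖q.2‖} := isOpen_lt continuous_const (continuous_norm.comp continuous_snd)
      have h2 : IsOpen {q : ℝ × E | ‖q.2‖ < ‖p.2‖ + 1} :=
        isOpen_lt (continuous_norm.comp continuous_snd) continuous_const
      exact h1.inter h2
    have hmem : p ∈ {q : ℝ × E | r + ε < ‖q.2‖ ∧ ‖q.2‖ < ‖p.2‖ + 1} := ⟨hp, by simp⟩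
    exact ((hpiece (‖p.2‖ + 1)).contDiffAt (hopen.mem_nhds hmem)).contDiffWithinAt
  intro R₀
  -- the cut-offs: `χ = 0` near the origin, `= 1` off `ball 0 ε`; `b = 1` on `closedBall 0 (|R₀| + |r|)`
  have hε2 : 0 < ε / 2 := by positivity
  let φ₁ : ContDiffBump (0 : E) := ⟨ε / 2, ε, hε2, by linarith⟩
  set R₁ : ℝ := |R₀| + |r| + 1 with hR₁
  have hR₁0 : 0 < R₁ := by positivity
  let φ₂ : ContDiffBump (0 : E) := ⟨R₁, R₁ + 1, hR₁0, by linarith⟩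
  set g : ℝ → E → ℝ := fun θ x => ((1 - φ₁ x) * φ₂ x) * heatKernelFwd ν (θ, x) with hg_def
  -- compact support in `x`, uniformly in `θ`
  have hgs : ∀ θ x, θ ∈ (univ : Set ℝ) → x ∉ closedBall (0 : E) (R₁ + 1) → g θ x = 0 := by
    intro θ x _ hx
    have : φ₂ x = 0 := by
      apply φ₂.zero_of_le_dist
      rw [dist_zero_right]
      rw [mem_closedBall, dist_zero_right, not_le] at hx
      exact hx.le
    simp [hg_def, this]
  -- joint smoothness of the cut-off kernel
  have hg : ContDiffOn ℝ ∞ ↿g (univ ×ˢ univ) := by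
    rw [univ_prod_univ, contDiffOn_univ]
    rw [contDiff_iff_contDiffAt]
    rintro ⟨θ, x⟩
    by_cases hx : ‖x‖ < ε / 2
    · -- near the origin the kernel is cut off
      have hzero : ↿g =ᶠ[𝓝 (θ, x)] fun _ => 0 := by
        have hopen : IsOpen {q : ℝ × E | ‖q.2‖ < ε / 2} :=
          isOpen_lt (continuous_norm.comp continuous_snd) continuous_const
        filter_upwards [hopen.mem_nhds (show (θ, x) ∈ {q : ℝ × E | ‖q.2‖ < ε / 2} from hx)] with q hq
        have h1 : φ₁ q.2 = 1 := φ₁.one_of_mem_closedBall (by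
          rw [mem_closedBall, dist_zero_right]; exact le_of_lt hq)
        simp [Function.HasUncurry.uncurry, hg_def, h1]
      exact (contDiffAt_const (c := (0 : ℝ))).congr_of_eventuallyEq hzero
    · have hx0 : x ≠ 0 := by
        intro h; rw [h, norm_zero] at hx; exact hx hε2
      have hK : ContDiffAt ℝ ∞ (heatKernelFwd (E := E) ν) (θ, x) :=
        (contDiffOn_heatKernelFwd hν).contDiffAt
          ((isOpen_ne_fun continuous_snd continuous_const).mem_nhds (by exact hx0))
      have hcut : ContDiff ℝ ∞ fun q : ℝ × E => (1 - φ₁ q.2) * φ₂ q.2 :=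
        ((contDiff_const.sub (φ₁.contDiff.comp contDiff_snd)).mul (φ₂.contDiff.comp contDiff_snd))
      have h := hcut.contDiffAt.mul hK
      exact h
  have hmain := contDiffOn_convolution_right_with_param (lsmul ℝ ℝ) (μ := (volume : Measure E))
    isOpen_univ (isCompact_closedBall (0 : E) (R₁ + 1)) hgs hρi hg
  rw [univ_prod_univ] at hmain
  -- on the piece the cut-offs are invisible
  refine (hmain.mono (subset_univ _)).congr fun p hp => ?_
  obtain ⟨hp1, hp2⟩ := hp
  show ∫ y, ρ y * heatKernelFwd ν (p.1, p.2 - y) = (ρ ⋆[lsmul ℝ ℝ, (volume : Measure E)] g p.1) p.2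
  rw [convolution_def]
  refine integral_congr_ae (Eventually.of_forall fun y => ?_)
  simp only [lsmul_apply, smul_eq_mul]
  by_cases hy : ρ y = 0
  · simp [hy]
  · have hyr := hρsupp y hy
    have hd1 : ε ≤ ‖p.2 - y‖ := by
      have h := norm_sub_norm_le p.2 y
      linarith
    have hd2 : ‖p.2 - y‖ ≤ R₁ := by
      have h1 : ‖p.2 - y‖ ≤ ‖p.2‖ + ‖y‖ := norm_sub_le _ _
      have h2 : ‖p.2‖ ≤ |R₀| := le_trans hp2.le (le_abs_self R₀)
      have h3 : ‖y‖ ≤ |r| := hyr.trans (le_abs_self r)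
      linarith
    have hφ₁ : φ₁ (p.2 - y) = 0 := φ₁.zero_of_le_dist (by rw [dist_zero_right]; exact hd1)
    have hφ₂ : φ₂ (p.2 - y) = 1 := φ₂.one_of_mem_closedBall (by rw [mem_closedBall, dist_zero_right]; exact hd2)
    simp [hg_def, hφ₁, hφ₂]

/-- For `θ > 0` the function `v ↦ ∫ ρ(y) W₊(θ, v - y) dy` is the heat flow `e^{νθΔ}ρ`. [folklore] -/
theorem conv_heatKernelFwd_eq_heatExtension (ν : ℝ) (ρ : E → ℝ) {θ : ℝ} (hθ : 0 < θ) :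
    (fun v : E => ∫ y, ρ y * heatKernelFwd ν (θ, v - y)) = UnboundedOperators.heatExtension ρ (ν * θ) := by
  funext v
  rw [UnboundedOperators.heatExtension_apply]
  have h := integral_sub_left_eq_self (μ := (volume : Measure E))
    (fun y => ρ y * heatKernelFwd ν (θ, v - y)) v
  rw [← h]
  refine integral_congr_ae (Eventually.of_forall fun y => ?_)
  simp only [sub_sub_cancel, smul_eq_mul]
  rw [heatKernelFwd_of_pos ν (by exact hθ), mul_comm]

/-- For `θ ≤ 0` the function `v ↦ ∫ ρ(y) W₊(θ, v - y) dy` vanishes. [folklore] -/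
theorem conv_heatKernelFwd_eq_zero (ν : ℝ) (ρ : E → ℝ) {θ : ℝ} (hθ : θ ≤ 0) :
    (fun v : E => ∫ y, ρ y * heatKernelFwd ν (θ, v - y)) = fun _ => 0 := by
  funext v
  have h : ∀ y : E, heatKernelFwd ν (θ, v - y) = 0 := fun y =>
    heatKernelFwd_of_nonpos ν (by exact hθ)
  simp [h]

end Conv

/-! ### Far-field smoothness of space–time potentials -/

/-- **Far-field smoothness**: let `k : ℝ × E → ℝ` be `C^∞` on an open set `O`, `F ∈ L¹(ℝ × E)`
vanishing a.e. off a compact set `A`, and `U` a bounded open set with `w - z ∈ O` for all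
`w ∈ closure U`, `z ∈ A`. Then `w ↦ ∫ k(w - z) F(z) dz` is `C^∞` on `U` (cut `k` off smoothly
to `O`; the cut-off kernel is smooth with compact support, so its convolution with `F` is smooth,
and it agrees with the potential on `U`). [folklore] -/
theorem contDiffOn_integral_kernel_of_separated {k : ℝ × E → ℝ} {O : Set (ℝ × E)} (hO : IsOpen O)
    (hk : ContDiffOn ℝ ∞ k O) {F : ℝ × E → ℝ} (hF : Integrable F volume) {A : Set (ℝ × E)}
    (hA : IsCompact A) (hFA : ∀ᵐ z ∂(volume : Measure (ℝ × E)), z ∉ A → F z = 0)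
    {U : Set (ℝ × E)} (hUb : Bornology.IsBounded U)
    (hsep : ∀ w ∈ closure U, ∀ z ∈ A, w - z ∈ O) :
    ContDiffOn ℝ ∞ (fun w => ∫ z, k (w - z) * F z) U := by
  haveI := isAddLeftInvariant_volume_real_prod (E := E)
  haveI := isNegInvariant_volume_real_prod (E := E)
  -- the compact set of differences
  set C : Set (ℝ × E) := (fun q : (ℝ × E) × (ℝ × E) => q.1 - q.2) '' (closure U ×ˢ A) with hC
  have hCc : IsCompact C := (hUb.isCompact_closure.prod hA).image (by fun_prop)
  have hCO : C ⊆ O := by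
    rintro v ⟨⟨w, z⟩, ⟨hw, hz⟩, rfl⟩
    exact hsep w hw z hz
  obtain ⟨δ, hδ, hδO⟩ := hCc.exists_cthickening_subset_open hO hCO
  -- a smooth cut-off `χ = 1` near `C`, supported inside `O`
  obtain ⟨χ, hχ, -, -, hχ1, hχsupp, -⟩ := Distribution.exists_smooth_cutoff C (δ := δ / 3) (by positivity)
  have hχO : tsupport χ ⊆ O := by
    refine hχsupp.trans ?_
    refine (thickening_subset_cthickening _ _).trans ?_
    rw [show 3 * (δ / 3) = δ by ring]
    exact hδO
  have hχc : HasCompactSupport χ := by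
    show IsCompact (tsupport χ)
    refine (hCc.cthickening (r := δ)).of_isClosed_subset (isClosed_tsupport χ) ?_
    refine hχsupp.trans ((thickening_subset_cthickening _ _).trans ?_)
    rw [show 3 * (δ / 3) = δ by ring]
  -- the cut-off kernel
  set kt : ℝ × E → ℝ := fun v => χ v * k v with hkt
  have hkt_smooth : ContDiff ℝ ∞ kt := by
    rw [contDiff_iff_contDiffAt]
    intro v
    by_cases hv : v ∈ O
    · exact hχ.contDiffAt.mul (hk.contDiffAt (hO.mem_nhds hv))
    · have hv' : v ∉ tsupport χ := fun h => hv (hχO h)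
      have hzero : kt =ᶠ[𝓝 v] fun _ => 0 := by
        filter_upwards [(isClosed_tsupport χ).isOpen_compl.mem_nhds hv'] with v' hv''
        simp [hkt, image_eq_zero_of_notMem_tsupport hv'']
      exact (contDiffAt_const (c := (0 : ℝ))).congr_of_eventuallyEq hzero
  have hkt_supp : HasCompactSupport kt := hχc.mul_right
  have hsm : ContDiff ℝ ∞ (kt ⋆[lsmul ℝ ℝ, (volume : Measure (ℝ × E))] F) :=
    hkt_supp.contDiff_convolution_left (lsmul ℝ ℝ) hkt_smooth hF.locallyIntegrable
  refine hsm.contDiffOn.congr fun w hw => ?_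
  show ∫ z, k (w - z) * F z = (kt ⋆[lsmul ℝ ℝ, (volume : Measure (ℝ × E))] F) w
  rw [convolution_lsmul_real_prod_apply]
  refine integral_congr_ae ?_
  filter_upwards [hFA] with z hz
  by_cases hzA : z ∈ A
  · have hwz : w - z ∈ C := ⟨(w, z), ⟨subset_closure hw, hzA⟩, rfl⟩
    have h1 : χ (w - z) = 1 := hχ1 _ (self_subset_thickening (by positivity) C hwz)
    simp [hkt, h1]
  · rw [hz hzA]
    simp

/-! ### Re-expansion of smooth functions as heat potentials -/

/-- **Re-expansion**: a function `R` smooth on an open `U ⊆ ℝ × E` agrees on any compact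
`K ⊆ U` with the forward heat potential `heatPotential ν β` of a continuous `β` compactly
supported inside `U` — namely `β = (∂ₜ - νΔ)(χR)` with `χ` a smooth cut-off equal to `1` near
`K` and supported in `U` (`HeatPotentialTestRepresentation.heatPotential_heatOperator`). [folklore] -/
theorem exists_heatPotential_eq_of_contDiffOn {R : ℝ × E → ℝ} {U : Set (ℝ × E)} (hU : IsOpen U)
    (hR : ContDiffOn ℝ ∞ R U) {K : Set (ℝ × E)} (hK : IsCompact K) (hKU : K ⊆ U) {ν : ℝ}
    (hν : 0 < ν) :
    ∃ β : ℝ × E → ℝ, Continuous β ∧ HasCompactSupport β ∧ tsupport β ⊆ U ∧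
      ∀ z ∈ K, heatPotential ν β z = R z := by
  obtain ⟨δ, hδ, hδU⟩ := hK.exists_cthickening_subset_open hU hKU
  obtain ⟨χ, hχ, -, -, hχ1, hχsupp, -⟩ :=
    Distribution.exists_smooth_cutoff K (δ := δ / 3) (by positivity)
  have hχsupp' : tsupport χ ⊆ cthickening δ K := by
    refine hχsupp.trans ((thickening_subset_cthickening _ _).trans ?_)
    rw [show 3 * (δ / 3) = δ by ring]
  have hχU : tsupport χ ⊆ U := hχsupp'.trans hδU
  have hχc : HasCompactSupport χ := by
    show IsCompact (tsupport χ)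
    exact (hK.cthickening (r := δ)).of_isClosed_subset (isClosed_tsupport χ) hχsupp'
  -- the test field `Φ = χ R`
  set Φ : ℝ × E → ℝ := fun z => χ z * R z with hΦ_def
  have hΦs : ContDiff ℝ ∞ Φ := by
    rw [contDiff_iff_contDiffAt]
    intro v
    by_cases hv : v ∈ U
    · exact hχ.contDiffAt.mul (hR.contDiffAt (hU.mem_nhds hv))
    · have hv' : v ∉ tsupport χ := fun h => hv (hχU h)
      have hzero : Φ =ᶠ[𝓝 v] fun _ => 0 := by
        filter_upwards [(isClosed_tsupport χ).isOpen_compl.mem_nhds hv'] with v' hv''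
        simp [hΦ_def, image_eq_zero_of_notMem_tsupport hv'']
      exact (contDiffAt_const (c := (0 : ℝ))).congr_of_eventuallyEq hzero
  have hΦc : HasCompactSupport Φ := hχc.mul_right
  have hΦU : tsupport Φ ⊆ U := (tsupport_mul_subset_left).trans hχU
  set Φc : ℝ → E → ℝ := fun t x => Φ (t, x) with hΦc_def
  have huc : uncurry Φc = Φ := by funext z; rfl
  have hΦt : IsSpaceTimeTestOn (⊤ : Opens (ℝ × E)) Φc :=
    ⟨by rw [huc]; exact hΦs, by rw [huc]; exact hΦc, fun _ _ => trivial⟩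
  -- the datum
  set β : ℝ × E → ℝ := fun w => timeDeriv Φc w.1 w.2 - ν • (Δ (Φc w.1)) w.2 with hβ_def
  have hβ0 : ∀ w : ℝ × E, w ∉ tsupport Φ → β w = 0 := by
    intro w hw
    have hw' : (w.1, w.2) ∉ tsupport (uncurry Φc) := by rw [huc]; exact hw
    simp only [hβ_def]
    rw [IsSpaceTimeTestOn.timeDeriv_eq_zero_of_notMem hw', laplacian_slice_eq_zero_of_notMem_tsupport hw',
      smul_zero, sub_zero]
  have hβsupp : tsupport β ⊆ tsupport Φ := by
    refine closure_minimal (fun w hw => ?_) (isClosed_tsupport Φ)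
    by_contra h
    exact hw (hβ0 w h)
  refine ⟨β, ?_, ?_, hβsupp.trans hΦU, ?_⟩
  · -- continuity
    have h1 : Continuous fun w : ℝ × E => timeDeriv Φc w.1 w.2 := hΦt.continuous_timeDeriv
    have h2 : Continuous fun w : ℝ × E => (Δ (Φc w.1)) w.2 := by
      have h := ((hΦt.isSmoothSpaceTimeOn univ).laplacian uniqueDiffOn_univ).continuousOn
      rw [univ_prod_univ, continuousOn_univ] at h
      exact h
    exact h1.sub (h2.const_smul ν)
  · show IsCompact (tsupport β)
    exact hΦc.of_isClosed_subset (isClosed_tsupport β) hβsupp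
  · intro z hz
    have h := hΦt.heatPotential_heatOperator hν z
    have hχz : χ z = 1 := hχ1 z (self_subset_thickening (by positivity) K hz)
    rw [hβ_def, h]
    simp [hΦc_def, hΦ_def, hχz]


/-! ### The reflected backward kernels of the three families, and their far-field smoothness -/

section Reflected

omit [FiniteDimensional ℝ E] [MeasurableSpace E] [BorelSpace E] in
/-- The reflected backward kernel of the heat family is `W₊(θ, -v)`. [folklore] -/
theorem backKernel_heatKernel_reflect_eq (ν : ℝ) (q : ℝ × E) :
    backKernel (fun a y => UnboundedOperators.heatKernel (ν * a) y) (-q) = heatKernelFwd ν (q.1, -q.2) := by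
  unfold backKernel heatKernelFwd
  simp only [Prod.fst_neg, Prod.snd_neg, neg_neg, Left.neg_neg_iff]

/-- The reflected backward kernel of `a ↦ ∂_c e^{νaΔ}ρ` is the slice derivative of
`(θ, v) ↦ ∫ ρ(y) W₊(θ, v - y) dy` at `(θ, -v)`. [folklore] -/
theorem backKernel_heatD1_reflect_eq (ν : ℝ) (ρ : E → ℝ) (c : E) (q : ℝ × E) :
    backKernel (fun a y => heatD1 (ν * a) c ρ y) (-q) =
      fderiv ℝ (fun v => ∫ y, ρ y * heatKernelFwd ν (q.1, v - y)) (-q.2) c := by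
  unfold backKernel
  simp only [Prod.fst_neg, Prod.snd_neg, neg_neg, Left.neg_neg_iff]
  by_cases hq : 0 < q.1
  · rw [if_pos hq, conv_heatKernelFwd_eq_heatExtension ν ρ hq]
    rfl
  · rw [if_neg hq, conv_heatKernelFwd_eq_zero ν ρ (not_lt.1 hq)]
    simp

/-- The reflected backward kernel of `a ↦ ∂ᵥ∂_c e^{νaΔ}ρ` is the second slice derivative of
`(θ, v) ↦ ∫ ρ(y) W₊(θ, v - y) dy` at `(θ, -v)`. [folklore] -/
theorem backKernel_heatD2_reflect_eq (ν : ℝ) (ρ : E → ℝ) (v c : E) (q : ℝ × E) :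
    backKernel (fun a y => heatD2 (ν * a) v c ρ y) (-q) =
      fderiv ℝ (fun x => fderiv ℝ (fun x' => ∫ y, ρ y * heatKernelFwd ν (q.1, x' - y)) x c) (-q.2) v := by
  unfold backKernel
  simp only [Prod.fst_neg, Prod.snd_neg, neg_neg, Left.neg_neg_iff]
  by_cases hq : 0 < q.1
  · rw [if_pos hq, conv_heatKernelFwd_eq_heatExtension ν ρ hq]
    rfl
  · rw [if_neg hq, conv_heatKernelFwd_eq_zero ν ρ (not_lt.1 hq)]
    simp

variable {ν : ℝ} {ρ : E → ℝ} {r : ℝ}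

omit [MeasurableSpace E] [BorelSpace E] [InnerProductSpace ℝ E] [FiniteDimensional ℝ E] in
/-- The far-field regions `ℝ × {‖v‖ > R}` are symmetric. [folklore] -/
theorem mapsTo_timeId_spaceNeg_farField (R : ℝ) :
    MapsTo (fun q : ℝ × E => ((q.1, -q.2) : ℝ × E)) {p : ℝ × E | R < ‖p.2‖} {p : ℝ × E | R < ‖p.2‖} :=
  fun q hq => by simpa using hq

omit [FiniteDimensional ℝ E] [MeasurableSpace E] [BorelSpace E] in
/-- **Far-field smoothness of the reflected heat kernel family.** [folklore] -/
theorem contDiffOn_backKernel_heatKernel_reflect (hν : 0 < ν) {R : ℝ} (hR : 0 ≤ R) :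
    ContDiffOn ℝ ∞ (fun q : ℝ × E => backKernel (fun a y => UnboundedOperators.heatKernel (ν * a) y) (-q))
      {p : ℝ × E | R < ‖p.2‖} := by
  have h := (contDiffOn_heatKernelFwd_of_norm (E := E) (n := (⊤ : ℕ∞)) hν hR).comp
    contDiff_timeId_spaceNeg.contDiffOn (mapsTo_timeId_spaceNeg_farField R)
  refine h.congr fun q _ => ?_
  exact backKernel_heatKernel_reflect_eq ν q

/-- **Far-field smoothness of the reflected kernel of `a ↦ ∂_c e^{νaΔ}ρ`** (`ρ` locally integrable,
supported in `‖y‖ ≤ r`), on `ℝ × {‖v‖ > r + ε}`. [folklore] -/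
theorem contDiffOn_backKernel_heatD1_reflect (hρi : LocallyIntegrable ρ volume)
    (hρsupp : ∀ y, ρ y ≠ 0 → ‖y‖ ≤ r) (hν : 0 < ν) {ε : ℝ} (hε : 0 < ε) (c : E) :
    ContDiffOn ℝ ∞ (fun q : ℝ × E => backKernel (fun a y => heatD1 (ν * a) c ρ y) (-q))
      {p : ℝ × E | r + ε < ‖p.2‖} := by
  have hO : IsOpen {p : ℝ × E | r + ε < ‖p.2‖} := isOpen_setOf_lt_norm_snd (r + ε)
  have hK₀ := contDiffOn_conv_heatKernelFwd hρi hρsupp hν hε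
  have hK₁ := ContDiffOn.slice_fderiv_apply hO hK₀ c
  have h := hK₁.comp contDiff_timeId_spaceNeg.contDiffOn (mapsTo_timeId_spaceNeg_farField (r + ε))
  refine h.congr fun q _ => ?_
  exact backKernel_heatD1_reflect_eq ν ρ c q

/-- **Far-field smoothness of the reflected kernel of `a ↦ ∂ᵥ∂_c e^{νaΔ}ρ`**, on
`ℝ × {‖v‖ > r + ε}`. [folklore] -/
theorem contDiffOn_backKernel_heatD2_reflect (hρi : LocallyIntegrable ρ volume)
    (hρsupp : ∀ y, ρ y ≠ 0 → ‖y‖ ≤ r) (hν : 0 < ν) {ε : ℝ} (hε : 0 < ε) (v c : E) :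
    ContDiffOn ℝ ∞ (fun q : ℝ × E => backKernel (fun a y => heatD2 (ν * a) v c ρ y) (-q))
      {p : ℝ × E | r + ε < ‖p.2‖} := by
  have hO : IsOpen {p : ℝ × E | r + ε < ‖p.2‖} := isOpen_setOf_lt_norm_snd (r + ε)
  have hK₀ := contDiffOn_conv_heatKernelFwd hρi hρsupp hν hε
  have hK₁ := ContDiffOn.slice_fderiv_apply hO hK₀ c
  have hK₂ := ContDiffOn.slice_fderiv_apply hO hK₁ v
  have h := hK₂.comp contDiff_timeId_spaceNeg.contDiffOn (mapsTo_timeId_spaceNeg_farField (r + ε))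
  refine h.congr fun q _ => ?_
  exact backKernel_heatD2_reflect_eq ν ρ v c q

/-- The truncated Newtonian kernel `Γ₀ = newtonNear r₀ r₁` is supported in `‖y‖ ≤ r₁`. [folklore] -/
theorem newtonNear_ne_zero_norm_le {r₀ r₁ : ℝ} (h₀ : 0 ≤ r₀) (h₁ : r₀ < r₁)
    (y : EuclideanSpace ℝ (Fin 3)) (hy : newtonNear r₀ r₁ y ≠ 0) : ‖y‖ ≤ r₁ := by
  by_contra h
  exact hy (newtonNear_eq_zero h₀ h₁ (not_le.1 h).le)

end Reflected

end General

end Literature.Analysis.FluidPDE
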